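import Mathlib
import HarnessLib
import Literature.NumberTheory.Automorphic.BaseChangeStrongAllFinite
import Literature.NumberTheory.Automorphic.BaseChangeStrongAllFiniteRankOne
import Literature.NumberTheory.Automorphic.BaseChangeStrongUnramifiedUnitaryReduction
import Summits.Langlands.Langlands.Theses.SkinnerWilesDefectOne
import Summits.Langlands.Langlands.Theorems.SkinnerWilesDefectOneStrongLiftingAllFiniteRamifiedClause

/-!
# `StrongLiftingAllFinite` (item stmt-Langlands-15194, route `SkinnerWilesDefectOne`):
# the route declaration BY NAME — link to the Literature fact, the named-leaf residue, low rank

The route statement `Summit.Langlands.Langlands.Theses.SkinnerWilesDefectOne.StrongLiftingAllFinite`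
is, verbatim (`IsWeakBaseChangeLiftAE` displayed unfolded), the named fact
`Literature.NumberTheory.Automorphic.ArthurClozel1989_strongLifting_allFinite` — Arthur–Clozel 1989,
Ch. 3, Thm. 5.1 read at ALL finite places: for `E/F` Galois of prime degree and cuspidal `π`, `P` on
`GL_n(𝔸_F)`, `GL_n(𝔸_E)` with `P` a weak base-change lift of `π`, at every finite `w ∣ v` where `π`
has the Satake parameter `α`, `P` has the Satake parameter `α^{f(w|v)}`.

The helper files `SkinnerWilesDefectOneStrongLiftingAllFinite*.lean` (prover-0) conclude the
Literature constant or the expanded signature; none imports the route file.  This file states the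
same results with the ROUTE DECLARATION AS CONCLUSION, BY NAME, so that the item closes in one line
the day any of the listed hypotheses is discharged:

* `iff_fact` (`Iff.rfl`), `of_fact` — item ⟺ Literature fact (so a proof of the item
  discharges the fact for every route, and `ArthurClozel1989_strongLifting_allFinite_holds` closes
  the item);
* `of_unramifiedLift_of_ramified` — item from (U) the unramified-places clause and (R) the ramified
  clause (`strongLiftingAllFinite_of_unramifiedLift_of_ramified`);
* `of_strongLifting_unramified_of_namedPackage`, `of_offS_of_namedPackage` — item from NAMED LEAVES
  of the tree only: the sibling fact `ArthurClozel1989_strongLifting_unramified`, resp. its five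
  `offS` leaves (Thm. 4.2 (a), (d) `S`-threaded, multiplicity one on `L²_cusp(GL_n)`,
  Jacquet–Shalika (2.2), (2.3)), plus the package `JPSS1983_twistedStandardLPackage_weakBaseChange`
  for (R) (`…RamifiedClause`);
* `rank_le_one` — the item's clause for `n ≤ 1`, UNCONDITIONALLY (proved in Literature:
  `ArthurClozel1989_strongLifting_allFinite.rank_zero/.rank_one`), and `of_two_le` — the item from
  its clause in ranks `n ≥ 2` alone.

All proofs are one-line logic over accepted declarations (no definition, no new named fact); the
conditional theorems are CONDITIONAL results and do not close the item.

## References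

* J. Arthur, L. Clozel, *Simple algebras, base change, and the advanced theory of the trace
  formula*, Ann. of Math. Stud. 120 (1989), Ch. 3 §1 (1.1), Def. 1.1–1.2, Thm. 4.2, Thm. 5.1
  (pp. 212–214); Ch. 1 §6. [ArthurClozelAMS120]
* R. P. Langlands, *Base change for GL(2)*, Ann. of Math. Stud. 96 (1980). [LanglandsBaseChange1980]
-/

set_option linter.dupNamespace false -- project-wide option (lakefile weak.linter.dupNamespace); `Summit.Langlands.Langlands` is the mandated namespace

noncomputable section

open scoped NumberField
open NumberField IsDedekindDomain MeasureTheory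
open Literature.NumberTheory.Automorphic

namespace Summit.Langlands.Langlands.Theorems.SkinnerWilesDefectOne.StrongLiftingAllFinite

open Summit.Langlands.Langlands.Theses.SkinnerWilesDefectOne (StrongLiftingAllFinite)

/-! ### Item ⟺ Literature fact -/

/-- **The item is the Literature fact**: the route statement `StrongLiftingAllFinite` and
`ArthurClozel1989_strongLifting_allFinite` are the same proposition (`IsWeakBaseChangeLiftAE`
unfolds by `Iff.rfl`); in particular `iff_fact.mp` discharges the Literature fact for every route
that cites it from a proof of the item.
[cite: ArthurClozelAMS120, Ch. 3 Thm. 5.1 with §1 (1.1) and Def. 1.1–1.2] -/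
theorem iff_fact : StrongLiftingAllFinite ↔ ArthurClozel1989_strongLifting_allFinite := Iff.rfl

/-- **The item from the Literature fact** (one line: the day
`ArthurClozel1989_strongLifting_allFinite_holds` lands, this closes stmt-Langlands-15194).
CONDITIONAL on the named fact. [cite: ArthurClozelAMS120, Ch. 3 Thm. 5.1] -/
theorem of_fact (h : ArthurClozel1989_strongLifting_allFinite) : StrongLiftingAllFinite :=
  iff_fact.mpr h

/-! ### The item from its two halves and from named leaves -/

/-- **The item from (U) and (R)**: (U) every weak base-change lift between cuspidal data in prime
degree is an unramified strong lift (`IsUnramifiedBaseChangeLift`, the relation at the finite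
places unramified in `E/F`), (R) at the places RAMIFIED in `E/F` where `π` is unramified the lift
has the same Satake parameter (`f(w|v) = 1` there, the degree being prime).  CONDITIONAL on (U), (R).
[cite: ArthurClozelAMS120, Ch. 3 Thm. 5.1 with §1 (1.1) and Def. 1.2] -/
theorem of_unramifiedLift_of_ramified
    (hU : ∀ (n : ℕ) (F E : Type) [Field F] [NumberField F] [Field E] [NumberField E] [Algebra F E]
      [IsGalois F E], (Module.finrank F E).Prime →
      ∀ (hF : isCompact_glFiniteIntegralLevel n F) (hE : isCompact_glFiniteIntegralLevel n E)
        (π : CuspidalAutomorphicRepData n F hF) (P : CuspidalAutomorphicRepData n E hE),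
        IsWeakBaseChangeLiftAE π.1 P.1 → IsUnramifiedBaseChangeLift π.1 P.1)
    (hR : ∀ (n : ℕ) (F E : Type) [Field F] [NumberField F] [Field E] [NumberField E] [Algebra F E]
      [IsGalois F E], (Module.finrank F E).Prime →
      ∀ (hF : isCompact_glFiniteIntegralLevel n F) (hE : isCompact_glFiniteIntegralLevel n E)
        (π : CuspidalAutomorphicRepData n F hF) (P : CuspidalAutomorphicRepData n E hE),
        IsWeakBaseChangeLiftAE π.1 P.1 →
          ∀ (w : HeightOneSpectrum (𝓞 E)) (v : HeightOneSpectrum (𝓞 F)) (α : Multiset ℂ),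
            w.asIdeal.under (𝓞 F) = v.asIdeal → ¬ Algebra.IsUnramifiedIn (𝓞 E) v.asIdeal →
              π.1.HasSatakeParamAt v α → P.1.HasSatakeParamAt w α) :
    StrongLiftingAllFinite :=
  strongLiftingAllFinite_of_unramifiedLift_of_ramified hU hR

/-- **The item from the sibling fact at the unramified places and the named package**:
(U) from `ArthurClozel1989_strongLifting_unramified` (Thm. 5.1 at the places unramified in `E/F`),
(R) from `JPSS1983_twistedStandardLPackage_weakBaseChange` (`ramifiedClause_of_namedPackage`).
CONDITIONAL on these two named facts. [cite: ArthurClozelAMS120, Ch. 3 Thm. 5.1] -/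
theorem of_strongLifting_unramified_of_namedPackage
    (h : ArthurClozel1989_strongLifting_unramified)
    (H : JPSS1983_twistedStandardLPackage_weakBaseChange) : StrongLiftingAllFinite :=
  strongLiftingAllFinite_of_strongLifting_unramified_of_namedPackage h H

/-- **The item from NAMED LEAVES of the tree only** — its exact residue: the five leaves of
`ArthurClozel1989_strongLifting_unramified_of_offS` (the `S`-threaded Thm. 4.2 (a) and (d),
multiplicity one on `L²_cusp(GL_n)`, Jacquet–Shalika (2.2), (2.3)) give (U), the named package
`JPSS1983_twistedStandardLPackage_weakBaseChange` gives (R).  CONDITIONAL on these six named facts;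
none of them is the twisted trace formula at a ramified place.
[cite: ArthurClozelAMS120, Ch. 3 Thm. 4.2 (a), (d) (pp. 203–207), Thm. 5.1 (pp. 212–214)]
[cite: JacquetShalikaAJM1981, §2 (2.2)–(2.3)] -/
theorem of_offS_of_namedPackage
    (ha : ∀ (n : ℕ) (F E : Type) [Field F] [NumberField F] [Field E] [NumberField E]
      [Algebra F E], ArthurClozel1989_weakLifting_cuspidal_offS n F E)
    (hd : ∀ (n : ℕ) (F E : Type) [Field F] [NumberField F] [Field E] [NumberField E]
      [Algebra F E], ArthurClozel1989_cuspidal_descent_offS n F E)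
    (hm1 : ∀ (n : ℕ) (K : Type) [Field K] [NumberField K]
      (μ : Measure (AdelicGroupData.gl n K).automorphicQuotient)
      [(AdelicGroupData.gl n K).IsAutomorphicMeasure μ], multiplicity_one_gl n K μ)
    (h22c : ∀ (n : ℕ) (K : Type) [Field K] [NumberField K]
      (μ : Measure (AdelicGroupData.gl n K).automorphicQuotient)
      [(AdelicGroupData.gl n K).IsAutomorphicMeasure μ],
      JacquetShalika1981_partialPairL_at_one_of_ne_conj (n := n) (K := K) (μ := μ))
    (h23 : ∀ (n : ℕ) (K : Type) [Field K] [NumberField K]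
      (μ : Measure (AdelicGroupData.gl n K).automorphicQuotient)
      [(AdelicGroupData.gl n K).IsAutomorphicMeasure μ],
      JacquetShalika1981_partialPairL_pole_of_eq_conj (n := n) (K := K) (μ := μ))
    (H : JPSS1983_twistedStandardLPackage_weakBaseChange) : StrongLiftingAllFinite :=
  strongLiftingAllFinite_of_offS_of_namedPackage ha hd hm1 h22c h23 H

/-! ### Low rank: the item holds outright for `n ≤ 1`; it reduces to the ranks `n ≥ 2` -/

/-- **The item's clause in ranks `n ≤ 1`, unconditionally.**  For `n = 0` both Satake parameters
are empty (`ArthurClozel1989_strongLifting_allFinite.rank_zero`); for `n = 1` it is the Hecke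
character case `P = χ ∘ N_{E/F}` at every finite place, proved in the tree from the weak relation
(`ArthurClozel1989_strongLifting_allFinite.rank_one`: strong multiplicity one for Hecke characters
and the local norm at a ramified place).  [cite: ArthurClozelAMS120, Ch. 3 Thm. 5.1 (n ≤ 1: Ch. 1 §6.2, class field theory)] -/
theorem rank_le_one (n : ℕ) (hn : n ≤ 1) (F E : Type) [Field F] [NumberField F] [Field E]
    [NumberField E] [Algebra F E] [IsGalois F E] (hprime : (Module.finrank F E).Prime)
    (hF : isCompact_glFiniteIntegralLevel n F) (hE : isCompact_glFiniteIntegralLevel n E)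
    (π : CuspidalAutomorphicRepData n F hF) (P : CuspidalAutomorphicRepData n E hE)
    (hBC : IsWeakBaseChangeLiftAE π.1 P.1)
    (w : HeightOneSpectrum (𝓞 E)) (v : HeightOneSpectrum (𝓞 F)) (α : Multiset ℂ)
    (hwv : w.asIdeal.under (𝓞 F) = v.asIdeal) (hα : π.1.HasSatakeParamAt v α) :
    P.1.HasSatakeParamAt w (α.map (· ^ w.asIdeal.inertiaDeg (𝓞 F))) := by
  interval_cases n
  · exact ArthurClozel1989_strongLifting_allFinite.rank_zero F E hF hE π P w v α hα
  · exact ArthurClozel1989_strongLifting_allFinite.rank_one F E hprime hF hE π P hBC w v α hwv hα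

/-- **The item reduces to the ranks `n ≥ 2`**: granted its clause for every `n ≥ 2` (the genuine
content of Arthur–Clozel Ch. 3 Thm. 5.1: `GL_n`, `n ≥ 2`, via the twisted trace formula; for
`n = 2` Langlands 1980), `StrongLiftingAllFinite` follows, the ranks `n ≤ 1` being `rank_le_one`.
CONDITIONAL on the displayed hypothesis. [cite: ArthurClozelAMS120, Ch. 3 Thm. 5.1] [cite: LanglandsBaseChange1980, §2] -/
theorem of_two_le
    (h2 : ∀ (n : ℕ), 2 ≤ n → ∀ (F E : Type) [Field F] [NumberField F] [Field E] [NumberField E]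
      [Algebra F E] [IsGalois F E], (Module.finrank F E).Prime →
      ∀ (hF : isCompact_glFiniteIntegralLevel n F) (hE : isCompact_glFiniteIntegralLevel n E)
        (π : CuspidalAutomorphicRepData n F hF) (P : CuspidalAutomorphicRepData n E hE),
        IsWeakBaseChangeLiftAE π.1 P.1 →
          ∀ (w : HeightOneSpectrum (𝓞 E)) (v : HeightOneSpectrum (𝓞 F)) (α : Multiset ℂ),
            w.asIdeal.under (𝓞 F) = v.asIdeal → π.1.HasSatakeParamAt v α →
              P.1.HasSatakeParamAt w (α.map (· ^ w.asIdeal.inertiaDeg (𝓞 F)))) :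
    StrongLiftingAllFinite := by
  intro n F E _ _ _ _ _ _ hprime hF hE π P hBC w v α hwv hα
  by_cases hn : n ≤ 1
  · exact rank_le_one n hn F E hprime hF hE π P hBC w v α hwv hα
  · exact h2 n (by omega) F E hprime hF hE π P hBC w v α hwv hα

end Summit.Langlands.Langlands.Theorems.SkinnerWilesDefectOne.StrongLiftingAllFinite

end
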